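import Mathlib
import Summits.Ventures.PercRepro2.SwAllMarkStepClasses
import Summits.Ventures.PercRepro2.SwAllLeafMark

/-!
# THE GENERAL MARK STEP, IV: the swap-closed pattern and the core pair behind a pendant `l`
(blind cell PercRepro2, night-4 g31, 2026-08-28; proofs/NIGHT4-G31.md)

**The swap lemma** (`gTypedSwAll_of_swap_closed`): on a class closed under the colour swap the
swap itself is the rigid injection (every red edge of `C_R(h)(ζ)` is blue in `blue ζ`).  For the
general mark step the pattern whose red neighbours are `l`, `h` or vertices isolated in the
isolated graph, with `l` itself isolated there (every edge at `l` goes to the mark), has a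
swap-closed class (`swap_mem_gTypedQ_mark`): the clusters of `l` are `{l}` in both colours, so
every condition of the class is decided by the pattern alone — `gTypedSwAll_mark_of_isolated_l`.
**THE CORE PAIR BEHIND A PENDANT `l`** (`swAll_markStep_of_pendant_l_junctionPair`): `l`'s edges
all go to the mark `x`; two junctions `u₁, u₂` (adjacent or not, joined to `h`, their other
neighbours joined to `h`), every other vertex hanging on `x` — g29 §10 (c)'s core pair
`u₁ ~ u₂`, both `h`-adjacent, is settled when the mark touches both and `l` is pendant at the
mark: on the patterns where a junction is a red neighbour of `x` it is exempt and the other one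
is g11's junction (or exempt too); on the pattern where neither is, the only red neighbour of `x`
in the isolated graph is `l` and the class is swap-closed.  Instance `exP` (the smallest member of
the 361-pair class at `n = 6` of mining/night-4/g31/gmark_6.txt): the mark `1` is a leaf at `5`
(g27's leaf-mark step), then the mark `5` with `l = 0` pendant and the core pair `3 ~ 4`:
**`swAll_exP : SwAll exP 0 2 1`**.
-/

namespace Summit.Ventures.PercRepro2

namespace LocRows

open Hull

variable {V : Type*} {E : Type*} [Fintype E] [DecidableEq E]

open scoped Classical

section Swap

variable {ends : E → Sym2 V}

omit [Fintype E] [DecidableEq E] in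
/-- The cluster of a vertex without edges is the singleton. -/
lemma cluster_eq_singleton_of_isolated {ω : Config E} {v : V} (hv : ∀ e, v ∉ ends e) :
    cluster ends ω v = {v} := by
  ext w
  constructor
  · intro hw
    have key : w ∈ {y | y = v} := by
      refine mem_of_conn_of_closed (ends := ends) (ω := ω) ?_ rfl hw
      intro a ha b hab
      simp only [Set.mem_setOf_eq] at ha
      obtain ⟨_, e, _, hends⟩ := openGraph_adj.1 hab
      exact absurd (by rw [hends, ha]; exact Sym2.mem_mk_left _ _) (hv e)
    exact key
  · rintro rfl
    exact mem_cluster_self _ _ _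

/-- **The swap lemma**: on a class closed under the colour swap, the swap is the rigid injection. -/
theorem gTypedSwAll_of_swap_closed {l h : V} {𝓤 𝓓 𝓓'' : Set (Set V)} {X : Set V}
    {𝓤' : Set (Set V)}
    (hsw : ∀ ζ ∈ gTypedQ ends l h 𝓤 𝓓 𝓓'' X 𝓤', blue ζ ∈ gTypedQ ends l h 𝓤 𝓓 𝓓'' X 𝓤') :
    GTypedSwAll ends l h 𝓤 𝓓 𝓓'' X 𝓤' := by
  refine ⟨fun ζ => blue ζ.1, ?_, fun ζ => ⟨hsw ζ.1 ζ.2, fun e _ he => ?_⟩⟩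
  · intro ζ ζ' hζ
    have := congrArg blue hζ
    rw [blue_blue, blue_blue] at this
    exact Subtype.ext this
  · show blue ζ.1 e = false
    rw [blue_apply, he]
    rfl

variable {x l h : V}

/-- **The swap-closed pattern**: with `l` isolated in the isolated graph and every red neighbour
of the pattern equal to `l`, to `h`, or isolated in the isolated graph, the class of the general
mark step is closed under the colour swap. -/
theorem swap_mem_gTypedQ_mark (hxh : x ≠ h) (hl : ∀ e, l ∉ isolate ends x e) {d : Config E}
    (hR : ∀ y ∈ openNbrs ends d x, y = l ∨ y = h ∨ ∀ e, y ∉ isolate ends x e) {ζ : Config E}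
    (hζ : ζ ∈ gTypedQ (isolate ends x) l h (markU ends d x) (markD ends d x) (markD'' ends d x)
      {x} Set.univ) :
    blue ζ ∈ gTypedQ (isolate ends x) l h (markU ends d x) (markD ends d x) (markD'' ends d x)
      {x} Set.univ := by
  rw [mem_gTypedQ] at hζ ⊢
  obtain ⟨hh, hU, hD, hD'', -, -⟩ := hζ
  have hcl : ∀ ω : Config E, cluster (isolate ends x) ω l = {l} :=
    fun _ => cluster_eq_singleton_of_isolated hl
  have hhl : h ≠ l := by
    intro h'
    exact hh (Or.inl (by rw [hcl, h']; exact Set.mem_singleton _))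
  refine ⟨?_, ?_, ?_, ?_, ?_, Set.mem_univ _⟩
  · rintro (h' | h') <;> rw [hcl] at h' <;> exact hhl h'
  · rw [hcl]
    rw [hcl] at hU
    exact hU
  · rw [blue_blue, hcl]
    rw [hcl] at hD
    exact hD
  · intro y hy hyh
    rcases hR y hy with rfl | rfl | hiso
    · rw [mem_cluster_comm, hcl] at hyh
      exact hhl hyh
    · exact hD'' y hy (mem_cluster_self _ _ _)
    · rw [mem_cluster_comm, cluster_eq_singleton_of_isolated hiso] at hyh
      exact hD'' y hy (hyh ▸ mem_cluster_self _ _ _)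
  · intro z hz
    rw [Set.mem_singleton_iff] at hz
    subst hz
    rintro (h' | h') <;> exact x_notMem_cluster_isolate hxh.symm h'

/-- **The general doubly typed row on the swap-closed pattern of the mark step.** -/
theorem gTypedSwAll_mark_of_isolated_l (hxh : x ≠ h) (hl : ∀ e, l ∉ isolate ends x e)
    (d : Config E) (hR : ∀ y ∈ openNbrs ends d x, y = l ∨ y = h ∨ ∀ e, y ∉ isolate ends x e) :
    GTypedSwAll (isolate ends x) l h (markU ends d x) (markD ends d x) (markD'' ends d x) {x}
      Set.univ :=
  gTypedSwAll_of_swap_closed fun _ hζ => swap_mem_gTypedQ_mark hxh hl hR hζ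

omit [Fintype E] [DecidableEq E] in
/-- When every edge at `l` goes to `x ≠ l`, `l` is isolated in the isolated graph. -/
lemma isolate_l_isolated (hxl : x ≠ l) (hl : ∀ e, l ∈ ends e → x ∈ ends e) :
    ∀ e, l ∉ isolate ends x e :=
  isolate_iso hxl.symm hl

end Swap

section CorePair

variable {ends : E → Sym2 V} {x l h : V}

/-- **THE CORE PAIR BEHIND A PENDANT `l`**: row 2′SW-ALL with the mark at `x` when every edge at
`l` goes to `x`, two junctions `u₁, u₂` (no loops; their neighbours other than `h` and `x` joined
to `h` — so they may be adjacent, both joined to `h`, and joined to `x`) and every other vertex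
hanging on `x`. -/
theorem swAll_markStep_of_pendant_l_junctionPair (hlh : l ≠ h) (hloop : ∀ e, ends e ≠ s(h, h))
    (hxl : x ≠ l) (hxh : x ≠ h) (hl : ∀ e, l ∈ ends e → x ∈ ends e) {u₁ u₂ : V}
    (hu₁l : u₁ ≠ l) (hu₁h : u₁ ≠ h) (hu₁x : u₁ ≠ x) (hu₂l : u₂ ≠ l) (hu₂h : u₂ ≠ h) (hu₂x : u₂ ≠ x)
    (hloop₁ : ∀ e, ends e ≠ s(u₁, u₁)) (hloop₂ : ∀ e, ends e ≠ s(u₂, u₂))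
    (hadj₁ : ∀ e y, ends e = s(u₁, y) → y ≠ h → y ≠ x → ∃ e', ends e' = s(y, h))
    (hadj₂ : ∀ e y, ends e = s(u₂, y) → y ≠ h → y ≠ x → ∃ e', ends e' = s(y, h))
    (hout : ∀ y, y ≠ l → y ≠ h → y ≠ x → y ≠ u₁ → y ≠ u₂ → ∀ e, y ∈ ends e → x ∈ ends e) :
    SwAll ends l h x := by
  refine swAll_of_gTyped_patterns hxl hxh fun d _ => ?_
  -- the junction theorem at `u` when the other junction `u'` is a red neighbour of the mark
  have hjun : ∀ u u' : V, u ≠ l → u ≠ h → u ≠ x → (∀ e, ends e ≠ s(u, u)) →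
      (∀ e y, ends e = s(u, y) → y ≠ h → y ≠ x → ∃ e', ends e' = s(y, h)) →
      (∀ y, y ≠ l → y ≠ h → y ≠ x → y ≠ u → y ≠ u' → ∀ e, y ∈ ends e → x ∈ ends e) →
      u ∉ openNbrs ends d x → u' ∈ openNbrs ends d x →
      GTypedSwAll (isolate ends x) l h (markU ends d x) (markD ends d x) (markD'' ends d x) {x}
        Set.univ := by
    intro u u' hul huh hux hloop_u hadj hout' huR hu'R
    refine gTypedSwAll_of_junction (F := fun y => y = x ∨ y ∈ openNbrs ends d x) hlh hul.symm
      huh.symm (isolate_hloop hxh hloop) (isolate_hloop hux.symm hloop_u) (isUpperSet_markU d x)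
      (isLowerSet_markD d x) (isLowerSet_markD'' d x) isUpperSet_univ ?_ ?_ ?_ (markF_exempt d)
      ?_ ?_
    · intro S hS y hy hyS
      rw [Set.mem_insert_iff] at hyS
      rcases hyS with rfl | hyS
      · exact huR hy
      · exact hS y hy hyS
    · intro S _
      exact Set.mem_univ _
    · simpa using hux
    · intro e he hoh
      have hxe : x ∉ ends e := by
        intro hxe
        rw [isolate_apply_of_mem hxe, Sym2.mem_iff] at he
        rcases he with h' | h' <;> exact hux h'
      have hends : ends e = s(u, Sym2.Mem.other he) := by
        rw [← isolate_apply_of_notMem hxe]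
        exact (Sym2.other_spec he).symm
      have hox : Sym2.Mem.other he ≠ x := by
        intro h'
        apply hxe
        rw [hends, h']
        exact Sym2.mem_mk_right _ _
      obtain ⟨e', he'⟩ := hadj e _ hends hoh hox
      exact ⟨e', isolate_eq_of_ends_eq hox hxh.symm he'⟩
    · intro y hyl hyh hyu
      by_cases hyx : y = x
      · exact Or.inl (Or.inl hyx)
      by_cases hyu' : y = u'
      · exact Or.inl (Or.inr (hyu' ▸ hu'R))
      exact Or.inr (Or.inr (isolate_iso hyx (hout' y hyl hyh hyx hyu hyu')))
  by_cases h₁ : u₁ ∈ openNbrs ends d x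
  · by_cases h₂ : u₂ ∈ openNbrs ends d x
    · -- both junctions exempt: g10's class
      refine gTypedSwAll_of_outEdges hlh (isolate_hloop hxh hloop) (isUpperSet_markU d x)
        (isLowerSet_markD d x) (isLowerSet_markD'' d x) isUpperSet_univ ?_
      intro y hyl hyh
      by_cases hyx : y = x
      · exact Or.inr (Or.inr (Or.inl (by simp [hyx])))
      by_cases hy₁ : y = u₁
      · exact Or.inr (Or.inl fun S hS => hS y (hy₁ ▸ h₁))
      by_cases hy₂ : y = u₂
      · exact Or.inr (Or.inl fun S hS => hS y (hy₂ ▸ h₂))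
      exact Or.inr (Or.inr (Or.inr (Or.inr (isolate_iso hyx (hout y hyl hyh hyx hy₁ hy₂)))))
    · exact hjun u₂ u₁ hu₂l hu₂h hu₂x hloop₂ hadj₂
        (fun y hyl hyh hyx hy₂ hy₁ => hout y hyl hyh hyx hy₁ hy₂) h₂ h₁
  · by_cases h₂ : u₂ ∈ openNbrs ends d x
    · exact hjun u₁ u₂ hu₁l hu₁h hu₁x hloop₁ hadj₁ hout h₁ h₂
    · -- neither junction is a red neighbour: the swap-closed pattern
      refine gTypedSwAll_mark_of_isolated_l hxh (isolate_l_isolated hxl hl) d fun y hy => ?_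
      by_cases hyl : y = l
      · exact Or.inl hyl
      by_cases hyh : y = h
      · exact Or.inr (Or.inl hyh)
      have hyx : y ≠ x := hy.1
      have hy₁ : y ≠ u₁ := fun h' => h₁ (h' ▸ hy)
      have hy₂ : y ≠ u₂ := fun h' => h₂ (h' ▸ hy)
      exact Or.inr (Or.inr (isolate_iso hyx (hout y hyl hyh hyx hy₁ hy₂)))

end CorePair

section Example

/-- `0–5, 1–5, 2–3, 2–4, 3–4, 3–5, 4–5`: `l = 0` pendant at `5`, `h = 2`, the core pair `3 ~ 4`
(both joined to `h` and to `5`), the mark `1` a leaf at `5`. -/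
def exP : Fin 7 → Sym2 (Fin 6)
  | 0 => s(0, 5) | 1 => s(1, 5) | 2 => s(2, 3) | 3 => s(2, 4) | 4 => s(3, 4) | 5 => s(3, 5)
  | 6 => s(4, 5)

/-- **Row 2′SW-ALL on `exP` with the mark at `5`**: `l = 0` pendant at the mark, the core pair
`3 ~ 4`, the leaf `1` hanging on the mark. -/
theorem swAll_exP5 : SwAll exP 0 2 5 := by
  refine swAll_markStep_of_pendant_l_junctionPair (u₁ := 3) (u₂ := 4) (by decide) (by decide)
    (by decide) (by decide) ?_ (by decide) (by decide) (by decide) (by decide) (by decide)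
    (by decide) (by decide) (by decide) (by decide) (by decide) ?_
  · intro e he
    fin_cases e <;> simp [exP, Sym2.mem_iff] at he ⊢
  · intro y hy0 hy2 hy5 hy3 hy4 e hye
    fin_cases y
    · exact absurd rfl hy0
    · fin_cases e <;> simp [exP, Sym2.mem_iff] at hye ⊢
    · exact absurd rfl hy2
    · exact absurd rfl hy3
    · exact absurd rfl hy4
    · exact absurd rfl hy5

/-- The mark `1` of `exP` is a leaf at `5`. -/
theorem exP_leaf : IsLeafAt exP 1 5 1 where
  ends₁ := by decide
  up := by decide
  only := by decide

/-- **Row 2′SW-ALL on `exP`** with `l = 0`, `h = 2`, the mark `1`: the leaf-mark step, then the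
core pair behind the pendant `l`. -/
theorem swAll_exP : SwAll exP 0 2 1 :=
  exP_leaf.swAll_leafMark (by decide) (by decide) swAll_exP5

/-- **Row (SW) on `exP`.** -/
theorem sw_exP : Sw exP 0 2 1 := sw_of_swAll exP swAll_exP

end Example

end LocRows

end Summit.Ventures.PercRepro2
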